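import Summits.MatrixMultiplication.MatrixMultiplication.Theorems.SaturationLadderHullCeiling
import HarnessLib

/-!
# SaturationLadder — the first-power `CW_q` family has uniform ceiling `≥ c₂`; the in-tree census

Route `SaturationLadder` (sub-problem `MatrixMultiplication`), crux `SubexpSaturation`
(stmt-MatrixMultiplication-25909), ladder `Base(θ)`.  Besides the STAGE-2 twin class, the tree holds ONE
other explicit family of far-edge certificates: the first-power `CW_q` family
`SaturationLadderExpSaturation.tight_cwFamily (q k c) (2 ≤ q) (1 ≤ k) (qk = k+1+c) (hent)`, members
`(t, r) = (k/(k+1), c/(k+1))`, whose entropy condition is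
`hent : 2 η(1/(q+2)) + η(1 − 2/(q+2)) ≤ h((2k+1)/((q+2)k))` (`η = negMulLog`, `h = binEntropy`).

* `log_q_lower`: `hent ⇒ log(q+2) ≥ 2k log 2 − 1` (convexity of `u log u`; so `q+2 ≥ 4^k/e`: the family
  lives at base `4`, the cell census's onset constant `log 4` made one-sided rigorous);
* `cw_member_bound`: hence every member with `k ≥ 20` has `(1 − t) log r ≥ c₂ = (5 log(5/4) + 3 log 2)/3`;
* `cwFamily_uniform_ceiling`: the family has uniform ceiling `≥ c₂` (indeed `τ = 20/21` serves every `ε`);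
* `no_subcritical_base_tree`: for `1 < θ`, `θ³ < 3125/128`, no finite convex combination of members of
  the twin class, of the `CW_q` family, and of ANY further family `Q` with uniform ceiling `≥ c₂`
  (e.g. every family with `t` bounded away from `1`: the `α`-cone points, the finitely many exact
  instances) certifies `Base(θ)` — the census form of the method ceiling `θ_c = (3125/128)^{1/3}` over
  everything the tree can presently produce at the far edge.

No definitions, no named facts, no sorry. [cite: CoppersmithWinograd1990, §6, §8]
[cite: AlmanDuanVassilevskaWilliamsXuXuZhou2025, Thm. 3.2, §3.4] [cite: LottiRomani1983, §1 (p. 173)]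
-/

set_option linter.dupNamespace false
-- (single-conjunct summit: the namespace repeats `MatrixMultiplication`)

noncomputable section

namespace Summit.MatrixMultiplication.MatrixMultiplication.Theorems.SaturationLadderCwFamilyCeiling

open Literature.Computability.AlgebraicComplexity
open Summit.MatrixMultiplication.MatrixMultiplication.Theorems.SaturationLadderTwinDefect
  (mul_log_tangent)
open Summit.MatrixMultiplication.MatrixMultiplication.Theorems.SaturationLadderHullCeiling
  (no_subcritical_base_mixed)

/-! ### §1  The entropy condition forces `q + 2 ≥ 4^k / e` -/

/-- `hent ⇒ log(q+2) ≥ 2k log 2 − 1`. [cite: CoppersmithWinograd1990, §6] -/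
theorem log_q_lower (q k : ℕ) (hq : 2 ≤ q) (hk : 1 ≤ k)
    (hent : 2 * Real.negMulLog (1 / ((q : ℝ) + 2)) + Real.negMulLog (1 - 2 * (1 / ((q : ℝ) + 2))) ≤
      Real.binEntropy ((2 * k + 1) / (((q : ℝ) + 2) * k))) :
    2 * (k : ℝ) * Real.log 2 - 1 ≤ Real.log ((q : ℝ) + 2) := by
  have hq' : (2 : ℝ) ≤ q := by exact_mod_cast hq
  have hk' : (1 : ℝ) ≤ k := by exact_mod_cast hk
  have hk0 : (0 : ℝ) < k := by linarith
  have hQ0 : (0 : ℝ) < (q : ℝ) + 2 := by linarith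
  set p : ℝ := 1 / ((q : ℝ) + 2) with hpdef
  have hp0 : 0 < p := by positivity
  have hp4 : p ≤ 1 / 4 := by
    rw [hpdef, div_le_div_iff₀ hQ0 (by norm_num)]; linarith
  set m : ℝ := (2 * (k : ℝ) + 1) / k with hmdef
  have hm2 : 2 ≤ m := by rw [hmdef, le_div_iff₀ hk0]; linarith
  have hm3 : m ≤ 3 := by rw [hmdef, div_le_iff₀ hk0]; linarith
  have hm0 : 0 < m := by linarith
  set x : ℝ := m * p with hxdef
  have hx : (2 * (k : ℝ) + 1) / (((q : ℝ) + 2) * k) = x := by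
    rw [hxdef, hmdef, hpdef]; field_simp
  have hx0 : 0 < x := mul_pos hm0 hp0
  have hx34 : x ≤ 3 / 4 := by
    have := mul_le_mul hm3 hp4 hp0.le (by norm_num); rw [← hxdef] at this; linarith
  have hxa : x - 2 * p = p / k := by
    rw [hxdef, hmdef]; field_simp; ring
  have ha0 : 0 ≤ x - 2 * p := by rw [hxa]; positivity
  rw [Real.binEntropy_eq_negMulLog_add_negMulLog_one_sub, hx] at hent
  simp only [Real.negMulLog] at hent
  -- convexity of `u log u` at `u₀ = 1 - 2p`
  have hT := mul_log_tangent (x₀ := 1 - 2 * p) (y := 1 - x) (by linarith) (by linarith)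
  have hlog12 : Real.log (1 - 2 * p) ≤ 0 := Real.log_nonpos (by linarith) (by linarith)
  have hT' : (1 - 2 * p) * Real.log (1 - 2 * p) - (x - 2 * p) ≤ (1 - x) * Real.log (1 - x) := by
    have := mul_le_mul_of_nonneg_right (show Real.log (1 - 2 * p) + 1 ≤ 1 by linarith) ha0
    have e : (Real.log (1 - 2 * p) + 1) * ((1 - x) - (1 - 2 * p)) =
        -((Real.log (1 - 2 * p) + 1) * (x - 2 * p)) := by ring
    rw [e] at hT
    linarith
  -- `log x = log m + log p`, `log m ≥ log 2`
  have hlogx : Real.log x = Real.log m + Real.log p := by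
    rw [hxdef, Real.log_mul hm0.ne' hp0.ne']
  have hlogm : Real.log 2 ≤ Real.log m := Real.log_le_log (by norm_num) hm2
  have hlog2 : 0 < Real.log 2 := Real.log_pos (by norm_num)
  have hF5 : 2 * p * Real.log 2 ≤ x * Real.log m := by
    have a1 : 2 * p * Real.log 2 ≤ x * Real.log 2 :=
      mul_le_mul_of_nonneg_right (by linarith) hlog2.le
    have a2 : x * Real.log 2 ≤ x * Real.log m := mul_le_mul_of_nonneg_left hlogm hx0.le
    linarith
  -- combine: `(x - 2p)(1 - log p) ≥ 2 p log 2`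
  have hkey : 2 * p * Real.log 2 ≤ (x - 2 * p) * (1 - Real.log p) := by
    have h1 : x * Real.log x - 2 * (p * Real.log p) ≤ x - 2 * p := by linarith
    rw [hlogx, mul_add] at h1
    nlinarith [h1, hF5]
  rw [hxa] at hkey
  have hkey' : p * (2 * (k : ℝ) * Real.log 2) ≤ p * (1 - Real.log p) := by
    have := hkey
    rw [div_mul_eq_mul_div, le_div_iff₀ hk0] at this
    linarith
  have hfin := le_of_mul_le_mul_left hkey' hp0
  have hlogp : Real.log p = - Real.log ((q : ℝ) + 2) := by
    rw [hpdef, one_div, Real.log_inv]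
  linarith

/-! ### §2  Members with `k ≥ 20` lie above `c₂` -/

/-- `c₂ = (5 log(5/4) + 3 log 2)/3 ≤ 111/100`. [folklore] -/
theorem c₂_le : (5 * Real.log (5 / 4) + 3 * Real.log 2) / 3 ≤ 111 / 100 := by
  have h1 : Real.log (5 / 4) ≤ 5 / 4 - 1 := Real.log_le_sub_one_of_pos (by norm_num)
  have h2 := Real.log_two_lt_d9
  norm_num at h2 ⊢
  linarith

/-- A `CW_q`-family member with `k ≥ 20` (and `log(q+2) ≥ 2k log 2 − 1`) has `r = c/(k+1) > 0` and
`(1 − t) log r ≥ c₂`, `t = k/(k+1)`. [cite: CoppersmithWinograd1990, §6] -/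
theorem cw_member_bound (q k c : ℕ) (hk : 20 ≤ k) (hqk : q * k = k + 1 + c)
    (hlog : 2 * (k : ℝ) * Real.log 2 - 1 ≤ Real.log ((q : ℝ) + 2)) :
    0 < (c : ℝ) / ((k : ℝ) + 1) ∧
      (5 * Real.log (5 / 4) + 3 * Real.log 2) / 3 ≤
        (1 - (k : ℝ) / ((k : ℝ) + 1)) * Real.log ((c : ℝ) / ((k : ℝ) + 1)) := by
  have hk' : (20 : ℝ) ≤ k := by exact_mod_cast hk
  have hk1 : (0 : ℝ) < (k : ℝ) + 1 := by linarith
  have hl2 := Real.log_two_gt_d9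
  have hl2' := Real.log_two_lt_d9
  norm_num at hl2 hl2'
  have hQ0 : (0 : ℝ) < (q : ℝ) + 2 := by positivity
  -- `q ≥ 6`
  have hq6 : (6 : ℝ) ≤ q := by
    rcases le_or_gt (6 : ℝ) q with h | h
    · exact h
    · exfalso
      have : Real.log ((q : ℝ) + 2) ≤ (q : ℝ) + 2 - 1 := Real.log_le_sub_one_of_pos hQ0
      have hkl := mul_le_mul hk' hl2.le (by norm_num) (by positivity)
      linarith
  have hc : (c : ℝ) = (q : ℝ) * k - k - 1 := by
    have : ((q * k : ℕ) : ℝ) = ((k + 1 + c : ℕ) : ℝ) := by rw [hqk]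
    push_cast at this; linarith
  -- `c/(k+1) ≥ (q+2)/4`
  have hr : ((q : ℝ) + 2) / 4 ≤ (c : ℝ) / ((k : ℝ) + 1) := by
    rw [div_le_div_iff₀ (by norm_num) hk1, hc]
    nlinarith [hq6, hk']
  have hr0 : 0 < (c : ℝ) / ((k : ℝ) + 1) := lt_of_lt_of_le (by positivity) hr
  refine ⟨hr0, ?_⟩
  have hlogr : 2 * ((k : ℝ) - 1) * Real.log 2 - 1 ≤ Real.log ((c : ℝ) / ((k : ℝ) + 1)) := by
    have h1 := Real.log_le_log (by positivity) hr
    rw [Real.log_div hQ0.ne' (by norm_num), show (4 : ℝ) = 2 ^ 2 by norm_num, Real.log_pow] at h1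
    push_cast at h1
    linarith
  have e : 1 - (k : ℝ) / ((k : ℝ) + 1) = 1 / ((k : ℝ) + 1) := by
    field_simp; ring
  rw [e, one_div_mul_eq_div, le_div_iff₀ hk1]
  have hc₂ := c₂_le
  nlinarith [hc₂, hlogr, hk', hl2]

/-! ### §3  Uniform ceiling of the `CW_q` family and the in-tree census -/

/-- The first-power `CW_q` family (`tight_cwFamily`, hypotheses verbatim) has uniform ceiling `≥ c₂`.
[cite: CoppersmithWinograd1990, §6] [cite: AlmanDuanVassilevskaWilliamsXuXuZhou2025, Thm. 3.2] -/
theorem cwFamily_uniform_ceiling (ε : ℝ) (hε : 0 < ε) : ∃ τ : ℝ, τ < 1 ∧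
    ∀ (q k c : ℕ), 2 ≤ q → 1 ≤ k → q * k = k + 1 + c →
      2 * Real.negMulLog (1 / ((q : ℝ) + 2)) + Real.negMulLog (1 - 2 * (1 / ((q : ℝ) + 2))) ≤
        Real.binEntropy ((2 * k + 1) / (((q : ℝ) + 2) * k)) →
      τ ≤ (k : ℝ) / ((k : ℝ) + 1) →
      0 < (c : ℝ) / ((k : ℝ) + 1) ∧
        (5 * Real.log (5 / 4) + 3 * Real.log 2) / 3 - ε ≤
          (1 - (k : ℝ) / ((k : ℝ) + 1)) * Real.log ((c : ℝ) / ((k : ℝ) + 1)) := by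
  refine ⟨20 / 21, by norm_num, ?_⟩
  intro q k c hq hk hqk hent hτ
  have hk1 : (0 : ℝ) < (k : ℝ) + 1 := by positivity
  have hk20 : 20 ≤ k := by
    rw [le_div_iff₀ hk1] at hτ
    have : (20 : ℝ) ≤ k := by linarith
    exact_mod_cast this
  obtain ⟨h0, h1⟩ := cw_member_bound q k c hk20 hqk (log_q_lower q k hq hk hent)
  exact ⟨h0, by linarith⟩

/-- **In-tree census of the far-edge method ceiling.**  For `1 < θ`, `θ³ < 3125/128`, no finite convex
combination of (i) members of any family `Q` with uniform ceiling `≥ c₂`, (ii) first-power `CW_q`-family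
members (`tight_cwFamily`), (iii) STAGE-2 twin-class members (`omegaRect_one_tw_exact`) certifies `Base(θ)`.
[cite: LottiRomani1983, §1 (p. 173)] [cite: CoppersmithWinograd1990, §6, §8]
[cite: AlmanDuanVassilevskaWilliamsXuXuZhou2025, Thm. 3.2, §3.4] -/
theorem no_subcritical_base_tree {θ C : ℝ} (hθ : 1 < θ) (hθc : θ ^ 3 < (3125 : ℝ) / 128)
    (Q : ℝ → ℝ → Prop) (hQ0 : ∀ t r, Q t r → t ≤ 1 ∧ 0 ≤ r)
    (hQ : ∀ ε : ℝ, 0 < ε → ∃ τ : ℝ, τ < 1 ∧ ∀ t r, Q t r → τ ≤ t →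
      0 < r ∧ (5 * Real.log (5 / 4) + 3 * Real.log 2) / 3 - ε ≤ (1 - t) * Real.log r)
    (H : ∀ s : ℝ, 0 ≤ s → s < 1 → ∃ (m : ℕ) (w t r : Fin m → ℝ), (∀ i, 0 ≤ w i) ∧
      ∑ i, w i = 1 ∧
      (∀ i, Q (t i) (r i) ∨
        (∃ (q k c : ℕ), 2 ≤ q ∧ 1 ≤ k ∧ q * k = k + 1 + c ∧
          2 * Real.negMulLog (1 / ((q : ℝ) + 2)) + Real.negMulLog (1 - 2 * (1 / ((q : ℝ) + 2))) ≤
            Real.binEntropy ((2 * k + 1) / (((q : ℝ) + 2) * k)) ∧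
          t i = (k : ℝ) / ((k : ℝ) + 1) ∧ r i = (c : ℝ) / ((k : ℝ) + 1)) ∨
        ∃ (j n₁ n₂ n₃ n₄ n₅ n₆ : ℕ), 0 < n₆ ∧ n₁ + n₄ + n₅ = 2 * n₆ ∧
          n₂ + n₃ = 2 ^ (j + 1) * n₆ ∧
          shannonEntropy ![((n₁ : ℝ) + n₄ + n₅) / (n₁ + n₂ + n₃ + n₄ + n₅ + n₆ : ℕ),
                ((n₂ : ℝ) + n₃) / (n₁ + n₂ + n₃ + n₄ + n₅ + n₆ : ℕ),
                (n₆ : ℝ) / (n₁ + n₂ + n₃ + n₄ + n₅ + n₆ : ℕ)] ≤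
              shannonEntropy ![((n₂ : ℝ) + n₄ + n₆) / (n₁ + n₂ + n₃ + n₄ + n₅ + n₆ : ℕ),
                ((n₁ : ℝ) + n₃) / (n₁ + n₂ + n₃ + n₄ + n₅ + n₆ : ℕ),
                (n₅ : ℝ) / (n₁ + n₂ + n₃ + n₄ + n₅ + n₆ : ℕ)] ∧
          shannonEntropy ![((n₁ : ℝ) + n₄ + n₅) / (n₁ + n₂ + n₃ + n₄ + n₅ + n₆ : ℕ),
                ((n₂ : ℝ) + n₃) / (n₁ + n₂ + n₃ + n₄ + n₅ + n₆ : ℕ),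
                (n₆ : ℝ) / (n₁ + n₂ + n₃ + n₄ + n₅ + n₆ : ℕ)] ≤
              shannonEntropy ![((n₃ : ℝ) + n₅ + n₆) / (n₁ + n₂ + n₃ + n₄ + n₅ + n₆ : ℕ),
                ((n₁ : ℝ) + n₂) / (n₁ + n₂ + n₃ + n₄ + n₅ + n₆ : ℕ),
                (n₄ : ℝ) / (n₁ + n₂ + n₃ + n₄ + n₅ + n₆ : ℕ)] ∧
          t i = (j : ℝ) * n₁ / (((j : ℝ) + 1) * n₃ + n₅) ∧
          r i = (((j : ℝ) + 1) * n₂ + n₁ + n₄) / (((j : ℝ) + 1) * n₃ + n₅)) ∧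
      s ≤ ∑ i, w i * t i ∧ ∑ i, w i * r i ≤ C * θ ^ (1 / (1 - s))) : False := by
  refine no_subcritical_base_mixed (C := C) hθ hθc
    (fun t r => Q t r ∨ ∃ (q k c : ℕ), 2 ≤ q ∧ 1 ≤ k ∧ q * k = k + 1 + c ∧
      2 * Real.negMulLog (1 / ((q : ℝ) + 2)) + Real.negMulLog (1 - 2 * (1 / ((q : ℝ) + 2))) ≤
        Real.binEntropy ((2 * k + 1) / (((q : ℝ) + 2) * k)) ∧
      t = (k : ℝ) / ((k : ℝ) + 1) ∧ r = (c : ℝ) / ((k : ℝ) + 1))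
    ?_ ?_ ?_
  · rintro t r (hq | ⟨q, k, c, -, -, -, -, rfl, rfl⟩)
    · exact hQ0 t r hq
    · have hk1 : (0 : ℝ) < (k : ℝ) + 1 := by positivity
      exact ⟨by rw [div_le_one hk1]; linarith, by positivity⟩
  · intro ε hε
    obtain ⟨τ₁, hτ₁, h₁⟩ := hQ ε hε
    obtain ⟨τ₂, hτ₂, h₂⟩ := cwFamily_uniform_ceiling ε hε
    refine ⟨max τ₁ τ₂, max_lt hτ₁ hτ₂, ?_⟩
    rintro t r (hq | ⟨q, k, c, hq2, hk, hqk, hent, rfl, rfl⟩) hτ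
    · exact h₁ t r hq ((le_max_left _ _).trans hτ)
    · exact h₂ q k c hq2 hk hqk hent ((le_max_right _ _).trans hτ)
  · intro s hs0 hs1
    obtain ⟨m, w, t, r, hw, hsum, hmem, hst, hr⟩ := H s hs0 hs1
    refine ⟨m, w, t, r, hw, hsum, fun i => ?_, hst, hr⟩
    rcases hmem i with h | h | h
    · exact Or.inl (Or.inl h)
    · exact Or.inl (Or.inr h)
    · exact Or.inr h

end Summit.MatrixMultiplication.MatrixMultiplication.Theorems.SaturationLadderCwFamilyCeiling
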